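import Summits.QuantumAdvantage.QuantumAdvantage.Theorems.MobiusLadderLiouvilleOrthogonalTC0StubMajTop
import Summits.QuantumAdvantage.QuantumAdvantage.Theorems.MobiusLadderLiouvilleOrthogonalTC0StubDepthTwoNf
import Summits.QuantumAdvantage.QuantumAdvantage.Theorems.MobiusLadderLiouvilleOrthogonalTC0FewMajSens3
import Literature.Computability.Complexity.GateValueConsistency
import HarnessLib

/-!
# Crux `MobiusLadder.LiouvilleOrthogonalTC0` (stmt-QuantumAdvantage-1393), line `Sketch`, skeleton v12:
stub `stub_fewMajSyntax` (U3) — conditioning a `tcBasis` circuit on its `O(1)` genuine majority gates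

SYNTACTIC representation behind the v12 rung "boundedly many majority gates anywhere". Let `C` be a
circuit on `n` bits over `tcBasis` with at most `j` GENUINE majority gates `S₀ < S₁ < ⋯` (fan-in `≥ 3`;
`MAJ₀, MAJ₁, MAJ₂ = ∧₀, ∧₁, ∨₂` live in `acBasis`), all gates of `acWeight`-depth `≤ dmax`, and assume
the wire-level substitution `hSub` (the neighbouring stub `stub_substStrong`): for every guess `v` of
the values of the genuine majority gates a program `gs'_v` over `acBasis`, gate for gate no deeper,
with the values of `C.gates` below `t` as soon as the guesses are right below `t`. Then
`C(x) = G(bits(x))` for a FIXED Boolean `G` on `J ≤ (j+1)2^j` bits, each a real threshold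
`[θ ≤ Σ_a w_a C_a(x)]` over ONE family of `K ≤ (j+1)2^j(size C + n)` circuits over `acBasis` of
`acDepth ≤ dmax`, `size ≤ size C`. For a guess `u ∈ {0,1}^{J₀}` let `C'_u` be the substituted program
with the output wire of `C`; the `c`-bit of `u` is `[1 ≤ C'_u(x)] = C'_u(x)`;
* the `t`-bit of `(i, u)` is the gate `C.gates[Sᵢ] = MAJ_k` read on the wires of `C'_u`:
  `[k ≤ Σ_z 2·#{a | args a = z}·P_{u,i,z}(x)]`, `z` over the `≤ size C + n` wires of `C`, `P_{u,i,z}`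
  the prefix circuit of the first `Sᵢ` gates of `C'_u` with output `z` (`StubMajTop.exists_prefix`;
  its `acDepth` is the depth of `z` in `gs'_u ≤` the depth of `z` in `C.gates ≤ dmax`);
* `G(t, c) = ∃ u, (∀ i, t_{i,u} = uᵢ) ∧ c_u`.
If `u` is right below `i`, then `gs'_u` and `C.gates` agree below `Sᵢ` (`prefix_agree`), so
`t_{i,u}(x) = MAJ_k(true arguments) = u*ᵢ`, `u*` the TRUE values: `u*` satisfies its clause
(`c_{u*}(x) = C(x)`), every `u ≠ u*` fails at its least wrong index (`eq_decide_exists_guess`).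
-/

set_option linter.dupNamespace false -- D-0017: single-problem summit ⇒ `QuantumAdvantage.QuantumAdvantage` by design
noncomputable section

namespace Summit.QuantumAdvantage.QuantumAdvantage.Theorems.LiouvilleOrthogonalTC0

open Finset Literature.Computability.Complexity Literature.Computability.Complexity.GateList

namespace StubFewMajSyntax

variable {n : ℕ}

/-- A circuit on `n` bits has an input (`n ≥ 1`) or a gate: `1 ≤ size C + n`. -/
theorem one_le_size_add (C : Circuit (Fin n)) : 1 ≤ C.size + n := by
  rcases hCo : C.output with i | m
  · have := Fin.pos i; omega
  · have : m < C.size := C.wf_output m hCo; omega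

/-- A wire of a program whose gate depths are dominated by depths all `≤ dmax` has depth `≤ dmax`. -/
theorem wireDepthOf_le_of_forall {gs : List (Gate (Fin n))} {ds : List ℕ} {dmax : ℕ}
    (hdepu : ∀ i, (wdepths acWeight gs).getD i 0 ≤ ds.getD i 0) (hdep : ∀ i, ds.getD i 0 ≤ dmax)
    (z : Fin n ⊕ ℕ) : wireDepthOf (wdepths acWeight gs) z ≤ dmax := by
  cases z with
  | inl i => exact Nat.zero_le _
  | inr m => exact (hdepu m).trans (hdep m)

/-- **The substituted circuit `C'_u`.** A well-formed program `gsu` over `acBasis`, as long as `C.gates`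
and gate for gate no deeper, with the output wire of `C`: over `acBasis`, size `size C`, `acDepth ≤ dmax`. -/
theorem subst_circuit (C : Circuit (Fin n)) {dmax : ℕ}
    (hdep : ∀ i, (wdepths acWeight C.gates).getD i 0 ≤ dmax)
    (gsu : List (Gate (Fin n))) (hwf : WF gsu) (hac : ∀ g ∈ gsu, g.fn ∈ acBasis)
    (hlen : gsu.length = C.gates.length)
    (hdepu : ∀ i, (wdepths acWeight gsu).getD i 0 ≤ (wdepths acWeight C.gates).getD i 0) :
    ∃ Cu : Circuit (Fin n), (Cu.IsOver acBasis ∧ Cu.acDepth ≤ dmax ∧ Cu.size ≤ C.size) ∧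
      ∀ x, Cu.eval x = wireOf x (vals gsu x) C.output := by
  refine ⟨toCircuit gsu C.output hwf (fun m hm => by rw [hlen]; exact C.wf_output m hm),
    ⟨fun g hg => hac g hg, ?_, le_of_eq hlen⟩, fun x => circuit_eval _ x⟩
  rw [Circuit.acDepth, circuit_depthWith]
  exact wireDepthOf_le_of_forall hdepu hdep _

/-- **The slot circuits `P_{u,i,z}`.** For a wire `z` into the first `t` gates, the prefix circuit of
the first `t` substituted gates with output `z` (`StubMajTop.exists_prefix`): over `acBasis`,
`acDepth ≤ dmax`, `size ≤ size C`, computing the value of `z` on the substituted program; for any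
other wire, the default circuit `D`. -/
theorem exists_slot (C : Circuit (Fin n)) {dmax : ℕ}
    (hdep : ∀ i, (wdepths acWeight C.gates).getD i 0 ≤ dmax)
    (gsu : List (Gate (Fin n))) (hwf : WF gsu) (hac : ∀ g ∈ gsu, g.fn ∈ acBasis)
    (hlen : gsu.length = C.gates.length)
    (hdepu : ∀ i, (wdepths acWeight gsu).getD i 0 ≤ (wdepths acWeight C.gates).getD i 0)
    (D : Circuit (Fin n)) (hD : D.IsOver acBasis ∧ D.acDepth ≤ dmax ∧ D.size ≤ C.size)
    (t : ℕ) (ht : t ≤ C.gates.length) (z : Fin n ⊕ ℕ) :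
    ∃ P : Circuit (Fin n), (P.IsOver acBasis ∧ P.acDepth ≤ dmax ∧ P.size ≤ C.size) ∧
      (OutOK t z → ∀ x, P.eval x = wireOf x (vals gsu x) z) := by
  by_cases hz : OutOK t z
  · set Cu : Circuit (Fin n) :=
      toCircuit gsu C.output hwf (fun m hm => by rw [hlen]; exact C.wf_output m hm) with hCu
    have hg : Cu.gates = gsu := rfl
    have ht' : t ≤ Cu.gates.length := by rw [hg, hlen]; exact ht
    obtain ⟨P, hP, hsz, hev, hd⟩ := StubMajTop.exists_prefix Cu t ht' z hz
      (fun j hj _ => hac _ (List.getElem_mem hj))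
    refine ⟨P, ⟨hP, ?_, ?_⟩, fun _ x => ?_⟩
    · rw [hd, StubMajTop.wireDepthOf_wdepths_take acWeight Cu.gates ht' z hz, hg]
      exact wireDepthOf_le_of_forall hdepu hdep z
    · exact hsz.trans_le ht
    · rw [hev x, StubMajTop.wireOf_vals_take Cu.gates ht' x z hz, hg]
  · exact ⟨D, hD, fun h => absurd h hz⟩

/-- **The `t`-bit.** A majority gate `g = MAJ_k` whose arguments are wires into the first `t` gates,
read on the value list `vs x`, is the real threshold `[k ≤ Σ_z 2 · #{a | g.args a = z} · P_z(x)]` over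
any finite set `W` of wires containing its arguments, for circuits `P_z` computing the wires `z` into
the first `t` gates (the other coefficients vanish). -/
theorem block_threshold {t : ℕ} (g : Gate (Fin n)) (hg : g.fn = GateFn.maj g.arity)
    (hOK : ∀ a, OutOK t (g.args a)) (W : Finset (Fin n ⊕ ℕ)) (hW : ∀ a, g.args a ∈ W)
    (vs : (Fin n → Bool) → List Bool) (P : {z // z ∈ W} → Circuit (Fin n))
    (hP : ∀ z : {z // z ∈ W}, OutOK t z.1 → ∀ x, (P z).eval x = wireOf x (vs x) z.1)
    (x : Fin n → Bool) :
    decide (((g.arity : ℕ) : ℝ) ≤ ∑ z : {z // z ∈ W},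
        (2 * ((univ.filter fun a => g.args a = z.1).card : ℝ)) *
          (if (P z).eval x then (1 : ℝ) else 0)) =
      g.op (fun a => wireOf x (vs x) (g.args a)) := by
  classical
  set y : {z // z ∈ W} → Bool := fun z => wireOf x (vs x) z.1 with hy
  set src : Fin g.arity → {z // z ∈ W} := fun a => ⟨g.args a, hW a⟩ with hsrc
  have hfun : (fun a => wireOf x (vs x) (g.args a)) = fun a => y (src a) := rfl
  have hfil : ∀ z : {z // z ∈ W},
      (univ.filter fun a => g.args a = z.1) = univ.filter fun a => src a = z := by
    intro z
    ext a
    simp only [mem_filter, mem_univ, true_and, hsrc, Subtype.ext_iff]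
  have hsum : ∑ z : {z // z ∈ W}, (2 * ((univ.filter fun a => g.args a = z.1).card : ℝ)) *
        (if (P z).eval x then (1 : ℝ) else 0) =
      2 * (GateFn.numOnes (fun a => y (src a)) : ℝ) := by
    rw [StubMajTop.cast_numOnes_comp src y, Finset.mul_sum]
    refine Finset.sum_congr rfl fun z _ => ?_
    rw [hfil z, mul_assoc]
    by_cases h0 : (univ.filter fun a => src a = z) = ∅
    · simp [h0]
    · obtain ⟨a, ha⟩ := Finset.nonempty_iff_ne_empty.2 h0
      have haz : src a = z := (mem_filter.1 ha).2
      rw [hP z (by rw [← haz]; exact hOK a) x]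
  rw [hsum, DepthTwoNf.op_of_fn_eq_maj g hg, hfun]
  simp only [decide_eq_decide]
  exact_mod_cast Iff.rfl

/-- **Prefix agreement.** If the guess `u` is right for the genuine majority gates `S i' < t`, the
substituted program (built from the guesses `m ↦ [∃ i, S i = m ∧ u i]`) and `C.gates` have the same
values below `t`. -/
theorem prefix_agree (C : Circuit (Fin n)) {J₀ : ℕ} (S : Fin J₀ → ℕ) (hS : StrictMono S)
    (hScov : ∀ (m : ℕ) (hm : m < C.gates.length),
      (∃ k, 3 ≤ k ∧ (C.gates[m]).fn = GateFn.maj k) → ∃ i, S i = m)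
    (u : Fin J₀ → Bool) (gsu : List (Gate (Fin n)))
    (hag : ∀ (x : Fin n → Bool) (t : ℕ),
      (∀ (m : ℕ) (hm : m < C.gates.length), m < t → (∃ k, 3 ≤ k ∧ (C.gates[m]).fn = GateFn.maj k) →
        decide (∃ i, S i = m ∧ u i = true) = (vals C.gates x).getD m false) →
      ∀ m, m < t → (vals gsu x).getD m false = (vals C.gates x).getD m false)
    (x : Fin n → Bool) (t : ℕ) (hu : ∀ i', S i' < t → u i' = (vals C.gates x).getD (S i') false) :
    ∀ m, m < t → (vals gsu x).getD m false = (vals C.gates x).getD m false := by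
  refine hag x t fun m hm hmt hmaj => ?_
  obtain ⟨i', rfl⟩ := hScov m hm hmaj
  rw [← hu i' hmt]
  have key : (∃ i, S i = S i' ∧ u i = true) ↔ u i' = true :=
    ⟨fun ⟨i, hi, h⟩ => by rwa [← hS.injective hi], fun h => ⟨i', rfl, h⟩⟩
  rw [show decide (∃ i, S i = S i' ∧ u i = true) = decide (u i' = true) from
    (decide_eq_decide.2 key), Bool.decide_eq_true]

/-- The value of gate `t` of `C` is its truth table on the substituted wires as soon as the
substituted program agrees with `C.gates` below `t` (the gate equation, `vals_consistent`). -/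
theorem gate_val_of_agree (C : Circuit (Fin n)) (gsu : List (Gate (Fin n))) (x : Fin n → Bool)
    {t : ℕ} (ht : t < C.gates.length)
    (hagree : ∀ m, m < t → (vals gsu x).getD m false = (vals C.gates x).getD m false) :
    (C.gates[t]).op (fun a => wireOf x (vals gsu x) ((C.gates[t]).args a)) =
      (vals C.gates x).getD t false := by
  rw [List.getD_eq_getElem?_getD, vals_consistent C.gates (wf_gates C) x t (C.gates[t])
    (List.getElem?_eq_getElem ht), Option.getD_some]
  congr 1
  funext a
  cases ha : (C.gates[t]).args a with
  | inl i => rfl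
  | inr m => exact hagree m (C.wf t ht a m ha)

/-- The output wire of `C` read on a substituted program agreeing with `C.gates` is `C(x)`. -/
theorem out_val_of_agree (C : Circuit (Fin n)) (gsu : List (Gate (Fin n))) (x : Fin n → Bool)
    (hagree : ∀ m, m < C.gates.length → (vals gsu x).getD m false = (vals C.gates x).getD m false) :
    wireOf x (vals gsu x) C.output = C.eval x := by
  rw [circuit_eval]
  rcases hCo : C.output with i | m
  · rfl
  · exact hagree m (C.wf_output m hCo)

/-- **The case analysis on the guess.** If every `t`-bit `bt i u` is the true value `u* i` as soon
as `u` is right below `i`, then `∃ u, (∀ i, bt i u = u i) ∧ bc u` singles out `u = u*`: the true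
vector satisfies its clause and every other vector fails at its least wrong index. -/
theorem eq_decide_exists_guess {J₀ : ℕ} (bt : Fin J₀ → (Fin J₀ → Bool) → Bool)
    (bc : (Fin J₀ → Bool) → Bool) (ustar : Fin J₀ → Bool) (e : Bool)
    [Decidable (∃ u : Fin J₀ → Bool, (∀ i, bt i u = u i) ∧ bc u = true)]
    (hT : ∀ u i, (∀ i', i' < i → u i' = ustar i') → bt i u = ustar i) (hc : bc ustar = e) :
    e = decide (∃ u : Fin J₀ → Bool, (∀ i, bt i u = u i) ∧ bc u = true) := by
  classical
  have key : (∃ u : Fin J₀ → Bool, (∀ i, bt i u = u i) ∧ bc u = true) ↔ e = true := by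
    refine ⟨?_, fun he => ⟨ustar, fun i => hT ustar i (fun _ _ => rfl), hc.trans he⟩⟩
    rintro ⟨u, hu, hcu⟩
    suffices h : u = ustar by rw [← hc, ← h, hcu]
    by_contra hne
    obtain ⟨i₀, hi₀⟩ := Function.ne_iff.1 hne
    obtain ⟨i, hi, hmin⟩ := (univ.filter fun i => u i ≠ ustar i).exists_min_image id
      ⟨i₀, mem_filter.2 ⟨mem_univ _, hi₀⟩⟩
    refine (mem_filter.1 hi).2 ((hu i).symm.trans (hT u i fun i' hlt' => ?_))
    by_contra hne'
    exact absurd hlt' (not_lt.2 (hmin i' (mem_filter.2 ⟨mem_univ _, hne'⟩)))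
  by_cases hP : ∃ u : Fin J₀ → Bool, (∀ i, bt i u = u i) ∧ bc u = true
  · rw [decide_eq_true hP]
    exact key.1 hP
  · rw [decide_eq_false hP]
    cases e
    · rfl
    · exact absurd (key.2 rfl) hP

/-- **Transport.** A representation `C(x) = G([θ_i ≤ Σ_b w_{ib} C_b(x)]_i)` indexed by finite types
`α` (bits) and `β` (circuits) is one indexed by `Fin |α|` and `Fin |β|`. -/
theorem transport {α β : Type*} [Fintype α] [Fintype β] (C : Circuit (Fin n)) (dmax Jb Kb : ℕ)
    (hJ : Fintype.card α ≤ Jb) (hK : Fintype.card β ≤ Kb)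
    (G : (α → Bool) → Bool) (Cs : β → Circuit (Fin n)) (w : α → β → ℝ) (θ : α → ℝ)
    (hCs : ∀ b, (Cs b).IsOver acBasis ∧ (Cs b).acDepth ≤ dmax ∧ (Cs b).size ≤ C.size)
    (hev : ∀ x : Fin n → Bool, C.eval x =
      G (fun i => decide (θ i ≤ ∑ b, w i b * (if (Cs b).eval x then (1 : ℝ) else 0)))) :
    ∃ (J K : ℕ) (G : (Fin J → Bool) → Bool) (Cs : Fin K → Circuit (Fin n))
      (w : Fin J → Fin K → ℝ) (θ : Fin J → ℝ),
      J ≤ Jb ∧ K ≤ Kb ∧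
      (∀ a, (Cs a).IsOver acBasis ∧ (Cs a).acDepth ≤ dmax ∧ (Cs a).size ≤ C.size) ∧
      ∀ x : Fin n → Bool, C.eval x =
        G (fun i => decide (θ i ≤ ∑ a, w i a * (if (Cs a).eval x then (1 : ℝ) else 0))) := by
  classical
  let eα := Fintype.equivFin α
  let eβ := Fintype.equivFin β
  refine ⟨Fintype.card α, Fintype.card β, fun bits => G (fun i => bits (eα i)),
    fun a => Cs (eβ.symm a), fun i' a => w (eα.symm i') (eβ.symm a), fun i' => θ (eα.symm i'),
    hJ, hK, fun a => hCs _, fun x => ?_⟩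
  have hs : ∀ i, ∑ a : Fin (Fintype.card β), w i (eβ.symm a) *
        (if (Cs (eβ.symm a)).eval x then (1 : ℝ) else 0) =
      ∑ b, w i b * (if (Cs b).eval x then (1 : ℝ) else 0) := fun i =>
    Equiv.sum_comp eβ.symm (fun b => w i b * (if (Cs b).eval x then (1 : ℝ) else 0))
  rw [hev x]
  congr 1
  funext i
  simp only [Equiv.symm_apply_apply, hs]

end StubFewMajSyntax

open StubMajTop StubFewMajSyntax in
/-- **Stub U3 (wave 5, v12) — conditioning on `≤ j` genuine majority gates.** Given the wire-level
substitution `hSub` (= `stub_substStrong`) and a bound `dmax` on ALL gate depths: `C(x) = G(thr(x))` for a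
Boolean `G` on `J ≤ (j+1)2^j` bits, the bits being real thresholds `[θ_i ≤ Σ_a w_{ia} C_a(x)]` over ONE
family of `K ≤ (j+1)2^j (size + n)` circuits over `acBasis` of `acDepth ≤ dmax`, `size ≤ size` (the
substituted circuits `C'_u` and their prefix circuits at the wires of `C`, one block per guess `u` of
the majority values; `G(t, c) = ∃ u, (∀ i, t_{i,u} = u_i) ∧ c_u`, see the module docstring). -/
theorem stub_fewMajSyntax
    (hSub : ∀ {n : ℕ} (v : ℕ → Bool) (gs : List (Gate (Fin n))), GateList.WF gs →
      (∀ g ∈ gs, g.fn ∈ tcBasis) →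
      ∃ gs' : List (Gate (Fin n)), GateList.WF gs' ∧ (∀ g ∈ gs', g.fn ∈ acBasis) ∧
        gs'.length = gs.length ∧
        (∀ i, (GateList.wdepths acWeight gs').getD i 0 ≤ (GateList.wdepths acWeight gs).getD i 0) ∧
        ∀ (x : Fin n → Bool) (t : ℕ),
          (∀ (i : ℕ) (hi : i < gs.length), i < t → (∃ k, 3 ≤ k ∧ (gs[i]).fn = GateFn.maj k) →
            v i = (GateList.vals gs x).getD i false) →
          ∀ i, i < t → (GateList.vals gs' x).getD i false = (GateList.vals gs x).getD i false)
    {n : ℕ} (C : Circuit (Fin n)) (hB : C.IsOver tcBasis) (j dmax : ℕ)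
    (hj : (Finset.univ.filter fun i : Fin C.gates.length =>
        3 ≤ (C.gates[i]).arity ∧ (C.gates[i]).fn = GateFn.maj (C.gates[i]).arity).card ≤ j)
    (hdep : ∀ i : ℕ, (GateList.wdepths acWeight C.gates).getD i 0 ≤ dmax) :
    ∃ (J K : ℕ) (G : (Fin J → Bool) → Bool) (Cs : Fin K → Circuit (Fin n))
      (w : Fin J → Fin K → ℝ) (θ : Fin J → ℝ),
      J ≤ (j + 1) * 2 ^ j ∧ K ≤ (j + 1) * 2 ^ j * (C.size + n) ∧
      (∀ a, (Cs a).IsOver acBasis ∧ (Cs a).acDepth ≤ dmax ∧ (Cs a).size ≤ C.size) ∧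
      ∀ x : Fin n → Bool, C.eval x =
        G (fun i => decide (θ i ≤ ∑ a, w i a * (if (Cs a).eval x then (1 : ℝ) else 0))) := by
  classical
  set M : Finset (Fin C.gates.length) := univ.filter fun i : Fin C.gates.length =>
      3 ≤ (C.gates[i]).arity ∧ (C.gates[i]).fn = GateFn.maj (C.gates[i]).arity with hM
  obtain ⟨J₀, hJ₀⟩ : ∃ J₀, M.card = J₀ := ⟨_, rfl⟩ -- the genuine majority gates `S 0 < S 1 < ⋯`
  have hJ₀j : J₀ ≤ j := hJ₀ ▸ hj
  set S : Fin J₀ → ℕ := fun i => ((M.orderEmbOfFin hJ₀ i : Fin C.gates.length) : ℕ) with hS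
  have hSlt : ∀ i, S i < C.gates.length := fun i => (M.orderEmbOfFin hJ₀ i).isLt
  have hSmono : StrictMono S := fun a b h => Fin.lt_def.1 ((M.orderEmbOfFin hJ₀).strictMono h)
  have hSgen : ∀ i, (C.gates[S i]'(hSlt i)).fn = GateFn.maj (C.gates[S i]'(hSlt i)).arity :=
    fun i => (mem_filter.1 (M.orderEmbOfFin_mem hJ₀ i)).2.2
  have hScov : ∀ (m : ℕ) (hm : m < C.gates.length),
      (∃ k, 3 ≤ k ∧ (C.gates[m]).fn = GateFn.maj k) → ∃ i, S i = m := by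
    intro m hm hmaj
    have hmem : (⟨m, hm⟩ : Fin C.gates.length) ∈ (M : Set (Fin C.gates.length)) :=
      Finset.mem_coe.2 (mem_filter.2 ⟨mem_univ _, (FewMaj3.fn_eq_bigMaj_iff _).1 hmaj⟩)
    rw [← Finset.range_orderEmbOfFin M hJ₀] at hmem
    exact hmem.imp fun i hi => show ((M.orderEmbOfFin hJ₀ i : Fin C.gates.length) : ℕ) = m by rw [hi]
  -- the substituted programs `gs u` and circuits `C'_u = Cu u`, one for each guess `u`
  choose gs hwf hac hlen hdepu hag using fun u : Fin J₀ → Bool =>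
    hSub (fun m => decide (∃ i, S i = m ∧ u i = true)) C.gates (wf_gates C) hB
  choose Cu hCup hCue using fun u : Fin J₀ → Bool =>
    subst_circuit C hdep (gs u) (hwf u) (hac u) (hlen u) (hdepu u)
  set W : Finset (Fin n ⊕ ℕ) :=
    (univ : Finset (Fin n)).image Sum.inl ∪ (range C.gates.length).image Sum.inr with hW
  have hWcard : W.card ≤ C.size + n := by
    refine (card_union_le _ _).trans ((Nat.add_le_add card_image_le card_image_le).trans ?_)
    rw [card_univ, Fintype.card_fin, card_range, Nat.add_comm]
    rfl
  have hargsW : ∀ (m : ℕ) (hm : m < C.gates.length) (a : Fin (C.gates[m]).arity),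
      (C.gates[m]).args a ∈ W := by
    intro m hm a
    cases ha : (C.gates[m]).args a with
    | inl i => exact mem_union_left _ (mem_image_of_mem _ (mem_univ i))
    | inr m' =>
      exact mem_union_right _ (mem_image_of_mem _ (mem_range.2 ((C.wf m hm a m' ha).trans hm)))
  choose P hPp hPe using fun (u : Fin J₀ → Bool) (i : Fin J₀) (z : {z // z ∈ W}) =>
    exists_slot C hdep (gs u) (hwf u) (hac u) (hlen u) (hdepu u) (Cu u) (hCup u) (S i)
      (hSlt i).le z.1
  set Cs' : ((Fin J₀ × (Fin J₀ → Bool)) × {z // z ∈ W}) ⊕ (Fin J₀ → Bool) → Circuit (Fin n) :=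
    Sum.elim (fun q => P q.1.2 q.1.1 q.2) (fun u => Cu u) with hCs'
  set w' : (Fin J₀ × (Fin J₀ → Bool)) ⊕ (Fin J₀ → Bool) →
      ((Fin J₀ × (Fin J₀ → Bool)) × {z // z ∈ W}) ⊕ (Fin J₀ → Bool) → ℝ :=
    Sum.elim
      (fun p => Sum.elim
        (fun q => if q.1 = p then
          2 * ((univ.filter fun a => (C.gates[S p.1]'(hSlt p.1)).args a = q.2.1).card : ℝ)
          else 0)
        (fun _ => 0))
      (fun u => Sum.elim (fun _ => 0) (fun u' => if u' = u then 1 else 0)) with hw'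
  set θ' : (Fin J₀ × (Fin J₀ → Bool)) ⊕ (Fin J₀ → Bool) → ℝ :=
    Sum.elim (fun p => ((C.gates[S p.1]'(hSlt p.1)).arity : ℝ)) (fun _ => 1) with hθ'
  have h2 : 2 ^ J₀ ≤ 2 ^ j := Nat.pow_le_pow_right (by norm_num) hJ₀j
  -- the representation: bits `α = (i, u) ⊕ u`, circuits `β = ((i, u), z) ⊕ u`, `z` a wire of `C`
  refine transport C dmax ((j + 1) * 2 ^ j) ((j + 1) * 2 ^ j * (C.size + n)) ?_ ?_
    (fun bits => decide (∃ u : Fin J₀ → Bool,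
      (∀ i, bits (Sum.inl (i, u)) = u i) ∧ bits (Sum.inr u) = true))
    Cs' w' θ' ?_ ?_
  · -- `J = (J₀ + 1) 2^{J₀} ≤ (j + 1) 2^j`
    calc Fintype.card ((Fin J₀ × (Fin J₀ → Bool)) ⊕ (Fin J₀ → Bool)) = (J₀ + 1) * 2 ^ J₀ := by
          simp only [Fintype.card_sum, Fintype.card_prod, Fintype.card_fun, Fintype.card_fin,
            Fintype.card_bool]
          ring
      _ ≤ (j + 1) * 2 ^ j := Nat.mul_le_mul (by omega) h2
  · -- `K = J₀ 2^{J₀} #W + 2^{J₀} ≤ (j + 1) 2^j (size + n)`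
    calc Fintype.card (((Fin J₀ × (Fin J₀ → Bool)) × {z // z ∈ W}) ⊕ (Fin J₀ → Bool))
          = J₀ * 2 ^ J₀ * W.card + 2 ^ J₀ := by
          simp only [Fintype.card_sum, Fintype.card_prod, Fintype.card_fun, Fintype.card_fin,
            Fintype.card_bool, Fintype.card_coe]
      _ ≤ J₀ * 2 ^ J₀ * (C.size + n) + 2 ^ J₀ * (C.size + n) := Nat.add_le_add
          (Nat.mul_le_mul_left _ hWcard) (Nat.le_mul_of_pos_right _ (one_le_size_add C))
      _ = (J₀ + 1) * 2 ^ J₀ * (C.size + n) := by ring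
      _ ≤ (j + 1) * 2 ^ j * (C.size + n) :=
          Nat.mul_le_mul_right _ (Nat.mul_le_mul (by omega) h2)
  · rintro (⟨⟨i, u⟩, z⟩ | u)
    · exact hPp u i z
    · exact hCup u
  · intro x -- the identity `C(x) = G(bits(x))`
    have hsumT : ∀ (i : Fin J₀) (u : Fin J₀ → Bool),
        ∑ k, w' (Sum.inl (i, u)) k * (if (Cs' k).eval x then (1 : ℝ) else 0) =
          ∑ z : {z // z ∈ W},
            (2 * ((univ.filter fun a => (C.gates[S i]'(hSlt i)).args a = z.1).card : ℝ)) *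
              (if (P u i z).eval x then (1 : ℝ) else 0) := by
      intro i u
      simp only [hw', hCs', Sum.elim_inl, Sum.elim_inr, Fintype.sum_sum_type, zero_mul,
        Finset.sum_const_zero, add_zero, ite_mul, Fintype.sum_prod_type, Finset.sum_ite_irrel,
        Finset.sum_ite_eq', mem_univ, if_true]
      exact Finset.sum_congr rfl fun z _ => by congr
    have hsumC : ∀ u : Fin J₀ → Bool,
        ∑ k, w' (Sum.inr u) k * (if (Cs' k).eval x then (1 : ℝ) else 0) =
          (if (Cu u).eval x then (1 : ℝ) else 0) := by
      intro u
      simp only [hw', hCs', Sum.elim_inl, Sum.elim_inr, Fintype.sum_sum_type, zero_mul,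
        Finset.sum_const_zero, zero_add, ite_mul, one_mul, Finset.sum_ite_eq', mem_univ, if_true]
      congr
    set ustar : Fin J₀ → Bool := fun i => (vals C.gates x).getD (S i) false with hustar
    refine eq_decide_exists_guess
      (fun i u => decide (θ' (Sum.inl (i, u)) ≤
        ∑ k, w' (Sum.inl (i, u)) k * (if (Cs' k).eval x then (1 : ℝ) else 0)))
      (fun u => decide (θ' (Sum.inr u) ≤
        ∑ k, w' (Sum.inr u) k * (if (Cs' k).eval x then (1 : ℝ) else 0)))
      ustar (C.eval x) ?_ ?_
    · -- the `t`-bits are right until the first wrong guess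
      intro u i hui
      show decide (((C.gates[S i]'(hSlt i)).arity : ℝ) ≤
        ∑ k, w' (Sum.inl (i, u)) k * (if (Cs' k).eval x then (1 : ℝ) else 0)) = ustar i
      rw [hsumT i u, block_threshold (C.gates[S i]'(hSlt i)) (hSgen i)
        (fun a m hm => C.wf _ (hSlt i) a m hm) W (hargsW _ (hSlt i)) (fun x => vals (gs u) x)
        (P u i) (hPe u i) x]
      exact gate_val_of_agree C (gs u) x (hSlt i)
        (prefix_agree C S hSmono hScov u (gs u) (hag u) x (S i)
          (fun i' hi' => hui i' (hSmono.lt_iff_lt.1 hi')))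
    · -- the `c`-bit of the true guess is `C(x)`
      show decide ((1 : ℝ) ≤
        ∑ k, w' (Sum.inr ustar) k * (if (Cs' k).eval x then (1 : ℝ) else 0)) = C.eval x
      rw [hsumC, decide_one_le_ite, hCue]
      exact out_val_of_agree C (gs ustar) x
        (prefix_agree C S hSmono hScov ustar (gs ustar) (hag ustar) x C.gates.length
          (fun i' _ => rfl))

end Summit.QuantumAdvantage.QuantumAdvantage.Theorems.LiouvilleOrthogonalTC0

end
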